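import Summits.HodgeConjecture.HodgeConjecture.Theses.GenericDivisibility
import Literature.AlgebraicGeometry.HodgeTheory.UnramifiedTorsionFreeCorollary
import Literature.AlgebraicTopology.SingularHomology.CohomologyOperations

/-!
# Route GenericDivisibility — `TorsionDiesGenerically` (item stmt-HodgeConjecture-18850)

The support item `TorsionDiesGenerically` of route `GenericDivisibility` is the "Bloch–Kato shadow"
of the route: on a smooth projective complex `2p`-fold `X` (`p ≥ 1`), an integral singular cohomology
class `w ∈ H^{2p}((X ∖ Z)(ℂ); ℤ)` on the complex points of a non-empty Zariski open (`Z` closed,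
`Z ≠ X`) that is killed by some `N ≥ 1` restricts to `0` on the complex points of a smaller non-empty
Zariski open `X ∖ Z'` (`Z ⊆ Z'` closed, `Z' ≠ X`).

This is exactly the PRINTED theorem of J.-L. Colliot-Thélène and C. Voisin, *Cohomologie non
ramifiée et conjecture de Hodge entière*, Duke Math. J. 161 (2012) = arXiv:1005.2778, Théorème 3.1
("les faisceaux `𝓗ᵖ_X(ℤ(i))` sont sans torsion"), unwound on presheaf sections in the middle degree;
its proof rests on the norm-residue isomorphism theorem (Rost–Voevodsky) together with the Bloch–Ogus
/ Artin comparison machinery, none of which exists in Mathlib or in the tree.  The tree vendors the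
theorem as the Literature named fact
`Literature.AlgebraicGeometry.HodgeTheory.ColliotTheleneVoisin2012_torsionDiesGenerically`
(`HodgeTheory/BettiTorsionDiesGenerically.lean`), whose body is the item VERBATIM up to the spelling
of the inclusion `(X ∖ Z')(ℂ) ↪ (X ∖ Z)(ℂ)` (`complexPointsComplInclusion h` there, the same
continuous map spelled inline in the route file), and as the stronger stalkwise all-degree fact
`ColliotTheleneVoisin2012_thm31_stalkTorsionFree` (`HodgeTheory/UnramifiedTorsionFree.lean`).

What this file records (all sorry-free):

* `genericDivisibility_torsionDiesGenerically_iff` — the route decl and the named fact are the same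
  proposition (`Iff.rfl`: the two inclusions are definitionally equal), so DISCHARGING the fact is
  literally proving the item, and conversely;
* `genericDivisibility_torsionDiesGenerically_of_colliotTheleneVoisin` — the item, CONDITIONAL on
  the named fact (trust base: Colliot-Thélène–Voisin 2012, Thm. 3.1);
* `genericDivisibility_torsionDiesGenerically_of_thm31` — the item, CONDITIONAL on the stalkwise
  form of the same theorem (pick a point outside `Z ≠ X`, via the Literature corollary
  `ColliotTheleneVoisin2012_torsionDiesGenerically_of_thm31`).

Deliberately NOT here: any attempt at the norm-residue theorem; the item stays open until the fact
is discharged (`ColliotTheleneVoisin2012_torsionDiesGenerically_holds`).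
-/

-- `Summit.HodgeConjecture.HodgeConjecture.Theorems` is the mandated namespace (single-problem summit:
-- Problem = Summit), which `linter.dupNamespace` flags on every declaration; the lakefile turns the
-- linter off tree-wide (weak option), restated here so stand-alone elaboration is warning-free too.
set_option linter.dupNamespace false

noncomputable section

namespace Summit.HodgeConjecture.HodgeConjecture.Theorems

open Literature.AlgebraicGeometry.HodgeTheory

/-- **Item = fact.** The route decl `GenericDivisibility.TorsionDiesGenerically` and the Literature
named fact `ColliotTheleneVoisin2012_torsionDiesGenerically` (Colliot-Thélène–Voisin 2012, Thm. 3.1 in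
elementary middle-degree form) are the same proposition: the route file spells the inclusion
`(X ∖ Z')(ℂ) ↪ (X ∖ Z)(ℂ)` inline, the fact uses `complexPointsComplInclusion h`, and the two bundled
continuous maps are definitionally equal (same function, proof-irrelevant continuity field).
[cite: ColliotTheleneVoisin2012, Thm 3.1] -/
theorem genericDivisibility_torsionDiesGenerically_iff :
    Summit.HodgeConjecture.HodgeConjecture.Theses.GenericDivisibility.TorsionDiesGenerically ↔
      ColliotTheleneVoisin2012_torsionDiesGenerically :=
  Iff.rfl

/-- **Item stmt-HodgeConjecture-18850 (`TorsionDiesGenerically`), CONDITIONAL form**: granted the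
named fact `ColliotTheleneVoisin2012_torsionDiesGenerically` (Colliot-Thélène–Voisin, Duke 161 (2012),
Théorème 3.1: the Zariski sheaf `𝓗^{2p}_X(ℤ)` is torsion-free, from the Rost–Voevodsky norm-residue
theorem), a torsion integral class on the complex points of a non-empty Zariski open of a smooth
projective complex `2p`-fold dies on a smaller non-empty Zariski open.  The conclusion's type is
literally the route decl; the hypothesis is the whole content (item = fact,
`genericDivisibility_torsionDiesGenerically_iff`). [cite: ColliotTheleneVoisin2012, Thm 3.1] -/
theorem genericDivisibility_torsionDiesGenerically_of_colliotTheleneVoisin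
    (h : ColliotTheleneVoisin2012_torsionDiesGenerically) :
    Summit.HodgeConjecture.HodgeConjecture.Theses.GenericDivisibility.TorsionDiesGenerically :=
  genericDivisibility_torsionDiesGenerically_iff.mpr h

/-- **Item stmt-HodgeConjecture-18850, CONDITIONAL on the stalkwise form**: granted
`ColliotTheleneVoisin2012_thm31_stalkTorsionFree` (Colliot-Thélène–Voisin 2012, Théorème 3.1 for all
degrees `q`, at every prescribed point `x ∉ Z`), the item follows by choosing any point outside
`Z ≠ X` (Literature corollary `ColliotTheleneVoisin2012_torsionDiesGenerically_of_thm31`).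
[cite: ColliotTheleneVoisin2012, Thm 3.1] -/
theorem genericDivisibility_torsionDiesGenerically_of_thm31
    (hf : ColliotTheleneVoisin2012_thm31_stalkTorsionFree) :
    Summit.HodgeConjecture.HodgeConjecture.Theses.GenericDivisibility.TorsionDiesGenerically :=
  genericDivisibility_torsionDiesGenerically_of_colliotTheleneVoisin
    (ColliotTheleneVoisin2012_torsionDiesGenerically_of_thm31 hf)

end Summit.HodgeConjecture.HodgeConjecture.Theorems

end

/-!
## The Bockstein bridge: the item is the surjectivity clause of Théorème 3.1 in degree `2p − 1`

Colliot-Thélène–Voisin prove Théorème 3.1 as the SHORT EXACT SEQUENCE of Zariski sheaves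
`0 → 𝓗^q_X(ℤ) →(×N) 𝓗^q_X(ℤ) → 𝓗^q_X(ℤ/N) → 0` for every `q`: torsion-freeness of `𝓗^{q+1}(ℤ)`
(injectivity of `×N`) is, through the Bockstein sequence
`H^q(U(ℂ); ℤ) →ρ H^q(U(ℂ); ℤ/N) →β̃ H^{q+1}(U(ℂ); ℤ) →N H^{q+1}(U(ℂ); ℤ)` of the coefficient sequence
`0 → ℤ →N ℤ → ℤ/N → 0` (Hatcher, *Algebraic Topology*, §3.E p. 303), the same thing as the
surjectivity of `𝓗^q(ℤ) → 𝓗^q(ℤ/N)` — and the latter is what the norm-residue isomorphism theorem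
delivers directly (at the generic point `H^q(ℂ(X), μ_N^{⊗q}) = K^M_q(ℂ(X))/N` is generated by symbols
of units, and the Kummer class of a unit `f` lifts to the integral class `f^*[dθ/2π]`; arXiv:1005.2778,
proof of Thm. 3.1).  The tree PROVES the Bockstein sequence (`CohomologyBockstein`: `integralBockstein`,
`reduceMod`, `exact_integralBockstein_lsmul`, `exact_reduceMod_integralBockstein`;
`CohomologyOperations`: `cohomologyBockstein_natural`), so we record, sorry-free:

* the pure algebraic-topology bridge for a continuous map `φ : F → E` (here an inclusion of complex
  points of Zariski opens): `φ^*` kills the `N`-torsion class `β̃ a` iff `φ^* a` is the reduction of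
  an integral class (`map_integralBockstein_eq_zero_of_exists_reduceMod`,
  `exists_reduceMod_of_map_integralBockstein_eq_zero`), and every `N`-torsion integral class is a
  `β̃ a` (`exists_integralBockstein_eq_of_nsmul_eq_zero`);
* `genericDivisibility_torsionDiesGenerically_iff_modN_lift` — the route decl
  `TorsionDiesGenerically` is EQUIVALENT to: every class in `H^{2p-1}((X ∖ Z)(ℂ); ℤ/N)` becomes the
  reduction of an integral class on the complex points of some smaller non-empty Zariski open
  (generic-stalk surjectivity of `𝓗^{2p-1}_X(ℤ) → 𝓗^{2p-1}_X(ℤ/N)`).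

This pins the literature debt of the item to ONE statement with finite coefficients in degree
`2p − 1` (for `p = 1`: Kummer theory + Riemann existence in degree `1`; for `p ≥ 2`: Rost–Voevodsky in
degree `2p − 1 ≥ 3`), which is also the shape the `C1` lines of the route manipulate (`z mod m`).
-/

noncomputable section

namespace Summit.HodgeConjecture.HodgeConjecture.Theorems

open CategoryTheory
open Literature.AlgebraicGeometry.Motives Literature.AlgebraicGeometry.HodgeTheory
open Literature.AlgebraicTopology.SingularHomology

section BocksteinBridge

variable {E F : Type} [TopologicalSpace E] [TopologicalSpace F]

/-- Multiplication by `m` on integral COEFFICIENTS induces multiplication by `m` on `Hⁿ(E; ℤ)`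
(functoriality of `Hⁿ(E; –)` in the coefficient module; Hatcher 2002, §3.1 p. 198). Same
computation as `Literature.Barriers.HodgeConjecture.singularCohomology_mapCoeff_lsmul_apply`,
restated with the `ℕ`-action used by the route decl (`N • w = 0`). [cite: HatcherAT2002, §3.1 p. 198] -/
theorem mapCoeff_lsmul_apply_eq_nsmul (m n : ℕ) (y : singularCohomology ℤ ℤ E n) :
    singularCohomology.mapCoeff E (LinearMap.lsmul ℤ ℤ m) n y = m • y := by
  have h₁ : singularCochainComplex.mapCoeff E (LinearMap.lsmul ℤ ℤ m : ℤ →ₗ[ℤ] ℤ) =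
      (m : ℤ) • 𝟙 (singularCochainComplex ℤ ℤ E) := by
    ext k φ σ
    simp only [singularCochainComplex.mapCoeff_apply, LinearMap.lsmul_apply, smul_eq_mul,
      HomologicalComplex.zsmul_f_apply, HomologicalComplex.id_f, ModuleCat.hom_zsmul,
      ModuleCat.hom_id]
    rfl
  have h₂ : singularCohomology.mapCoeff E (LinearMap.lsmul ℤ ℤ m) n =
      (m : ℤ) • 𝟙 (singularCohomology ℤ ℤ E n) := by
    change (HomologicalComplex.homologyFunctor _ _ n).map
      (singularCochainComplex.mapCoeff E (LinearMap.lsmul ℤ ℤ m : ℤ →ₗ[ℤ] ℤ)) = _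
    rw [h₁, Functor.map_zsmul, CategoryTheory.Functor.map_id]
    rfl
  rw [h₂, ← natCast_zsmul]
  rfl

/-- **Naturality of the integral Bockstein** `β̃ₘ : Hⁿ(–; ℤ/m) → Hⁿ⁺¹(–; ℤ)` in the space: for a
continuous `φ : F → E`, `φ^* ∘ β̃ₘ = β̃ₘ ∘ φ^*` (Hatcher 2002, §3.E p. 303, §4.L p. 488; the tree's
`cohomologyBockstein_natural` for the coefficient sequence `0 → ℤ →ᵐ ℤ → ℤ/m → 0`).
[cite: HatcherAT2002, §4.L p. 488] -/
theorem integralBockstein_natural (m : ℕ) [NeZero m] (φ : C(F, E)) (n : ℕ) :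
    integralBockstein E m n ≫ singularCohomology.map ℤ ℤ φ (n + 1) =
      singularCohomology.map ℤ (ZMod m) φ n ≫ integralBockstein F m n :=
  cohomologyBockstein_natural _ _ _ _ _ φ n

/-- **An `m`-torsion integral class is an integral Bockstein**: if `m • t = 0` in `Hⁿ⁺¹(E; ℤ)`
(`m ≥ 1`) then `t = β̃ₘ a` for some `a ∈ Hⁿ(E; ℤ/m)` (exactness of
`Hⁿ(E; ℤ/m) →β̃ Hⁿ⁺¹(E; ℤ) →ᵐ Hⁿ⁺¹(E; ℤ)`, Hatcher 2002, §3.E p. 303).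
[cite: HatcherAT2002, §3.E p. 303] -/
theorem exists_integralBockstein_eq_of_nsmul_eq_zero (m : ℕ) [NeZero m] (n : ℕ)
    (t : singularCohomology ℤ ℤ E (n + 1)) (ht : m • t = 0) :
    ∃ a : singularCohomology ℤ (ZMod m) E n, integralBockstein E m n a = t := by
  have hex := exact_integralBockstein_lsmul E m n
  rw [ShortComplex.moduleCat_exact_iff] at hex
  exact hex t (by rw [← ht]; exact mapCoeff_lsmul_apply_eq_nsmul m (n + 1) t)

/-- **Integral Bockstein images are `m`-torsion**: `m • β̃ₘ a = 0` (the composite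
`Hⁿ(E; ℤ/m) →β̃ Hⁿ⁺¹(E; ℤ) →ᵐ Hⁿ⁺¹(E; ℤ)` vanishes; Hatcher 2002, §3.E p. 303).
[cite: HatcherAT2002, §3.E p. 303] -/
theorem nsmul_integralBockstein_eq_zero (m : ℕ) [NeZero m] (n : ℕ)
    (a : singularCohomology ℤ (ZMod m) E n) : m • integralBockstein E m n a = 0 := by
  rw [← mapCoeff_lsmul_apply_eq_nsmul]
  change (integralBockstein E m n ≫ singularCohomology.mapCoeff E (LinearMap.lsmul ℤ ℤ m) (n + 1))
    a = 0
  rw [integralBockstein_comp_lsmul]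
  rfl

/-- **`ker β̃ₘ = im ρₘ`** on `Hⁿ(E; ℤ/m)`: a mod-`m` class has zero integral Bockstein iff it is the
reduction of an integral class (exactness of `Hⁿ(E; ℤ) →ρ Hⁿ(E; ℤ/m) →β̃ Hⁿ⁺¹(E; ℤ)`, Hatcher 2002,
§3.E p. 303). [cite: HatcherAT2002, §3.E p. 303] -/
theorem integralBockstein_eq_zero_iff_exists_reduceMod (m : ℕ) [NeZero m] (n : ℕ)
    (a : singularCohomology ℤ (ZMod m) E n) :
    integralBockstein E m n a = 0 ↔ ∃ b : singularCohomology ℤ ℤ E n, reduceMod E m n b = a := by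
  constructor
  · intro h
    have hex := exact_reduceMod_integralBockstein E m n
    rw [ShortComplex.moduleCat_exact_iff] at hex
    exact hex a h
  · rintro ⟨b, rfl⟩
    change (reduceMod E m n ≫ integralBockstein E m n) b = 0
    rw [reduceMod_comp_integralBockstein]
    rfl

/-- **Bockstein bridge, lifting ⇒ torsion dies.** For a continuous `φ : F → E` and
`a ∈ Hⁿ(E; ℤ/m)`: if `φ^* a` is the reduction of an integral class on `F`, then `φ^*` kills the
`m`-torsion class `β̃ₘ a ∈ Hⁿ⁺¹(E; ℤ)` (naturality of `β̃` and `β̃ ∘ ρ = 0`; Hatcher 2002, §3.E p. 303).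
[cite: HatcherAT2002, §3.E p. 303] -/
theorem map_integralBockstein_eq_zero_of_exists_reduceMod (m : ℕ) [NeZero m] (φ : C(F, E))
    (n : ℕ) (a : singularCohomology ℤ (ZMod m) E n)
    (h : ∃ b : singularCohomology ℤ ℤ F n,
      reduceMod F m n b = singularCohomology.map ℤ (ZMod m) φ n a) :
    singularCohomology.map ℤ ℤ φ (n + 1) (integralBockstein E m n a) = 0 := by
  change (integralBockstein E m n ≫ singularCohomology.map ℤ ℤ φ (n + 1)) a = 0
  rw [integralBockstein_natural, ModuleCat.comp_apply,
    integralBockstein_eq_zero_iff_exists_reduceMod]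
  exact h

/-- **Bockstein bridge, torsion dies ⇒ lifting.** For a continuous `φ : F → E` and
`a ∈ Hⁿ(E; ℤ/m)`: if `φ^*` kills `β̃ₘ a ∈ Hⁿ⁺¹(E; ℤ)`, then `φ^* a ∈ Hⁿ(F; ℤ/m)` is the reduction of
an integral class (naturality of `β̃` and `ker β̃ = im ρ`; Hatcher 2002, §3.E p. 303).
[cite: HatcherAT2002, §3.E p. 303] -/
theorem exists_reduceMod_of_map_integralBockstein_eq_zero (m : ℕ) [NeZero m] (φ : C(F, E))
    (n : ℕ) (a : singularCohomology ℤ (ZMod m) E n)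
    (h : singularCohomology.map ℤ ℤ φ (n + 1) (integralBockstein E m n a) = 0) :
    ∃ b : singularCohomology ℤ ℤ F n,
      reduceMod F m n b = singularCohomology.map ℤ (ZMod m) φ n a := by
  change (integralBockstein E m n ≫ singularCohomology.map ℤ ℤ φ (n + 1)) a = 0 at h
  rw [integralBockstein_natural, ModuleCat.comp_apply,
    integralBockstein_eq_zero_iff_exists_reduceMod] at h
  exact h

end BocksteinBridge

/-- **Item `TorsionDiesGenerically` = generic-stalk surjectivity of `𝓗^{2p-1}_X(ℤ) → 𝓗^{2p-1}_X(ℤ/N)`.**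
The route decl (Colliot-Thélène–Voisin 2012, Thm. 3.1, injectivity of `×N` on `𝓗^{2p}_X(ℤ)` at the
generic stalk: an `N`-torsion class on the complex points of a non-empty Zariski open of a smooth
projective `2p`-fold dies on a smaller non-empty Zariski open) is EQUIVALENT to the surjectivity
clause of the same printed short exact sequence one degree lower: every class
`a ∈ H^{2p-1}((X ∖ Z)(ℂ); ℤ/N)` (`Z` closed, `Z ≠ X`, `N ≥ 1`) becomes, on the complex points of some
smaller non-empty Zariski open `X ∖ Z'` (`Z ⊆ Z'` closed, `Z' ≠ X`), the reduction mod `N` of an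
INTEGRAL class.  Proof: the Bockstein sequence of `0 → ℤ →N ℤ → ℤ/N → 0` and its naturality under
the inclusion `(X ∖ Z')(ℂ) ↪ (X ∖ Z)(ℂ)` (`→`: apply the decl to the `N`-torsion class `β̃ a`;
`←`: an `N`-torsion `w` is `β̃ a`, and `β̃` kills reductions).  This is the form in which the
norm-residue theorem yields Thm. 3.1 in the source (symbols of units lift integrally), so the
literature debt of item stmt-HodgeConjecture-18850 is exactly this finite-coefficient lifting
statement in degree `2p − 1`. [cite: ColliotTheleneVoisin2012, Thm 3.1] [cite: HatcherAT2002, §3.E p. 303] -/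
theorem genericDivisibility_torsionDiesGenerically_iff_modN_lift :
    Summit.HodgeConjecture.HodgeConjecture.Theses.GenericDivisibility.TorsionDiesGenerically ↔
      ∀ ⦃p : ℕ⦄ ⦃X : SchemeOver ℂ⦄, 1 ≤ p → IsSmoothProjective (2 * p) X →
        ∀ (Z : Set X.left), IsClosed Z → Z ≠ Set.univ → ∀ (N : ℕ) [NeZero N]
          (a : singularCohomology ℤ (ZMod N) (complexPointsCompl X Z) (2 * p - 1)),
          ∃ (Z' : Set X.left) (h : Z ⊆ Z'), IsClosed Z' ∧ Z' ≠ Set.univ ∧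
            ∃ b : singularCohomology ℤ ℤ (complexPointsCompl X Z') (2 * p - 1),
              reduceMod (complexPointsCompl X Z') N (2 * p - 1) b =
                singularCohomology.map ℤ (ZMod N) (complexPointsComplInclusion h) (2 * p - 1) a := by
  constructor
  · intro hT p X hp hX Z hZ hZu N _
    have hT' := hT hp hX Z hZ hZu
    obtain ⟨n, hn1, hn2⟩ : ∃ n : ℕ, 2 * p - 1 = n ∧ 2 * p = n + 1 := ⟨2 * p - 1, rfl, by omega⟩
    rw [hn1]
    rw [hn2] at hT'
    intro a
    obtain ⟨Z', h, hZ', hZ'u, h0⟩ := hT' (integralBockstein _ N n a) N NeZero.one_le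
      (nsmul_integralBockstein_eq_zero N n a)
    exact ⟨Z', h, hZ', hZ'u,
      exists_reduceMod_of_map_integralBockstein_eq_zero N (complexPointsComplInclusion h) n a h0⟩
  · intro hL p X hp hX Z hZ hZu
    have hL' := hL hp hX Z hZ hZu
    obtain ⟨n, hn1, hn2⟩ : ∃ n : ℕ, 2 * p - 1 = n ∧ 2 * p = n + 1 := ⟨2 * p - 1, rfl, by omega⟩
    rw [hn1] at hL'
    rw [hn2]
    intro w N hN hw
    haveI : NeZero N := NeZero.of_pos hN
    obtain ⟨a, rfl⟩ := exists_integralBockstein_eq_of_nsmul_eq_zero N n w hw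
    obtain ⟨Z', h, hZ', hZ'u, hb⟩ := hL' N a
    exact ⟨Z', h, hZ', hZ'u,
      map_integralBockstein_eq_zero_of_exists_reduceMod N (complexPointsComplInclusion h) n a hb⟩

end Summit.HodgeConjecture.HodgeConjecture.Theorems

end
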